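/-
Copyright (c) 2026 the pub-hodgecm-mathlib formalisation cell (harness21).  Prover seat hodgecm-mathlib-A-p19 (g28): «S3-ram» seeding wave (LEAD F0P3a-plan (g12)
T11-88∕T11-89; owner F0P3a-p06 (g15)), socket (Lit2) of the fold v7.6 — the ANISOTROPIC (opposite-sign) v-deep literal at a tamely ramified CM place, II; 2026-09-02.
-/
import Literature.NumberTheory.Rogawski1990.TwoDeepAnisotropicLiteralRamified                       -- (this seat) I: `exists_signedGenerator_coords_ramified`, `exists_twistData_ramified`
import Literature.NumberTheory.LocalFields.UnramifiedQuadraticFixedSquares                            -- ★ `isSquare_coe_of_isUnit_of_isSquare_residue` (Hensel)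
import Literature.NumberTheory.Rogawski1990.EndoscopicEmbedding                                       -- ★ `endoGL`, `endoForm`, `endoGL_mem_iff`, `coe_endoGL_eq`
import HarnessLib

/-!
# The opposite-sign 2-deep literal of a type-(2) element at a TAMELY RAMIFIED CM place, II: the anisotropic unimodular plane, the `3 × 3` dress, the integral isometry
# onto `J₀` and the literal `Y = P·ι(G₁, u)·P⁻¹` (Rogawski 1990 §3.5 Prop. 3.5.2, §3.6, §4.9; Labesse–Langlands 1979 §2; Jacobowitz 1962 §8)

Topic `NumberTheory/Rogawski1990`; namespace `Literature.NumberTheory.Rogawski1990`.  THEOREMS ONLY (no definition, no instance, no notation, no named fact, no `sorry`); kernel lane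
`--supports stmt-HodgeConjecture-24833`.  Cell `pub/hodgecm-mathlib` (D-0151), crux H413; road «S3-ram», fold `LocalTransferAtOneTameRamified` v7.6 (fold pen F0P3-p02 (g17)), socket
**(Lit2)** `stub_typeTwo_literals_{even,odd}_ram`.  The frame literal `t₀` (sign `(y_λ,θ)_v`) is ★ F0P3a-p03 (g17) `TypeTwoRamifiedFrameLiteral`; this file finishes the construction,
inside `U(σ_w, J₀)(L_w)`, of the element `Y` whose pull-back along the wave's one-place frame (★ p846897) is the literal of the OPPOSITE sign.
HONEST LABEL: HC_CM is proved only modulo the cell's 2 remaining named inputs (hLiu418 24832, h413 24833) until rung 0 closes; unconditional local algebra, count-neutral.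

THE MATHEMATICS (continuing part I: `g = φ₀ + φ₁Π ∈ U(Φ₂)`, `Π² = D` a non-square UNIT, `Π⋆ = s₀Π`, twist data `x² − Dy² ≡ −s₀`).
* `exists_anisotropicBlock_ram`: the cyclic frame `C = (1 p; 0 r)`, `G₁ := C⁻¹gC = (φ₀ φ₁D; φ₁ φ₀) ≡ 1 (mod ϖ²)` (★ `valued_coords_of_entrywise_le`: NO level loss since `|D| = 1`),
  the intertwining `ι(C,1)·ι(G₁,u) = ι(g,u)·ι(C,1)` in `GL₃` (matrix level, ★ `literal_mul_cyclicFrame_eq`), and the UNIMODULAR σ-hermitian plane `Ψ = (x, yD; s₀Dy, s₀Dx)`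
  with `G₁ ∈ U(Ψ)` (★ `regRep_unitary`) whose class `η = (−det Ψ)⁻¹ ≡ D⁻¹·(unit square)` is a σ-fixed unit which is NOT a norm: a σ-fixed unit norm has square residue
  (★ (U1) `exists_mul_galAdicCompletionMap_eq_iff_isSquare_residue_of_ramified_complexConj`) and Hensel (★ `isSquare_coe_of_isUnit_of_isSquare_residue`) would make `D` a square.
* `exists_anisotropicLiteral_ram`: `H₃ := endoForm Ψ (η)` has `−det H₃ = 1 = σ1·1`, so ★ p846940 `exists_glInt_formCongr_antidiagonal_eq_of_map_mul_self_eq_neg_det_adicCompletion`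
  gives `P ∈ GL₃(𝒪_w)` with `ᵗσ̄P·J₀·P = H₃`; for `u ∈ GL₁(L_w)` with `σu·u = 1`, `u ≡ 1 (mod ϖ²)`: `Y := P·endoGL(G₁, u)·P⁻¹ ∈ U(σ_w, J₀)` is `≡ 1 (mod ϖ²)`, is
  `GL₃(L_w)`-conjugate to the endoscopic pattern `endoGL(g, u)`, and `q := P e₁` is a `u`-eigenvector of `Y` of `J₀`-length exactly `η`.  The heads file pulls `Y` back along the
  frame and reads `κ = −κ(t₀)` with ★ `finKappaAt_eq_ite_of_onePlace_eigenvector` (F0P3a-p03) and the index-two dichotomy ★ `exists_norm_mul_nonNorm_iff`.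

## References
* [Rogawski1990] J. D. Rogawski, *Automorphic Representations of Unitary Groups in Three Variables*, Ann. of Math. Stud. 123 (1990), §3.5 Prop. 3.5.2 (a)(c) p. 29, §3.6 p. 31,
  §4.3 (4.3.2) p. 43, §4.8 Case (a) p. 53, §4.9 Prop. 4.9.1 p. 55, §14.2 p. 233.
* [LabesseLanglands1979] J.-P. Labesse, R. P. Langlands, *L-indistinguishability for SL(2)*, Canad. J. Math. 31 (1979), §2 pp. 8–10.
* [Jacobowitz1962] R. Jacobowitz, *Hermitian forms over local fields*, Amer. J. Math. 84 (1962), §7 Thm. 7.1, §8.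
* [Serre1979] J.-P. Serre, *Local Fields*, GTM 67 (1979), Ch. V §3 Prop. 5, Cor. 2; Ch. II §3 (Hensel).
-/

set_option autoImplicit false

noncomputable section

open NumberField IsDedekindDomain Matrix Polynomial
open Literature.NumberTheory.Automorphic Literature.NumberTheory.Automorphic.UnitaryGroup Literature.NumberTheory.Automorphic.UnitaryLatticeTree
open Literature.NumberTheory.GaloisRepresentations
open Literature.NumberTheory.LocalFields.UnramifiedQuadraticNorm
open Literature.NumberTheory.LocalFields.RamifiedPlaceNormDictionary Literature.NumberTheory.LocalFields.RamifiedPlaceUnitNorms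
open scoped MatrixGroups ValuativeRel

namespace Literature.NumberTheory.Rogawski1990

section CM

variable (L : Type) [Field L] [NumberField L] [IsCMField L] {v : HeightOneSpectrum (𝓞 ↥(maximalRealSubfield L))}
  (w : PlacesOver L v) (hw : IsCMField.complexConj L • w.1 = w.1)

/-! ## §3 (continued from part I) The anisotropic literal `Y = P · endoGL(G₁, u) · P⁻¹ ∈ U(σ_w, J₀)`: 2-deep, `GL₃`-conjugate to the pattern, `u`-eigenvector of NON-NORM length -/

/-- `det (endoForm J₂ J₁) = det J₂ · det J₁` (block-diagonal after the `endoPerm` reindexing). [cite: Rogawski1990, §4.8 Case (a) p. 53] -/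
theorem det_endoForm {S : Type*} [CommRing S] (J₂ : Matrix (Fin 2) (Fin 2) S) (J₁ : Matrix (Fin 1) (Fin 1) S) :
    (endoForm J₂ J₁).det = J₂.det * J₁.det := by
  rw [endoForm_eq, Matrix.det_fin_three, Matrix.det_fin_two, Matrix.det_fin_one]
  simp
  ring


/-- A `1 × 1` unitary relation: `σ(a)·η·a = η` when `σa·a = 1`. [cite: Rogawski1990, §4.8 Case (a) p. 53] -/
theorem oneByOne_map_transpose_mul_mul {K : Type*} [Field K] (σ : K →+* K) {a : K} (η : K) (h : σ a * a = 1) :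
    ((!![a] : Matrix (Fin 1) (Fin 1) K).map σ)ᵀ * !![η] * !![a] = !![η] := by
  ext i j; fin_cases i; fin_cases j
  simp [Matrix.mul_apply]
  linear_combination η * h



/-- A `1 × 1` hermitian block: `(σ(η))ᵀ = (η)` when `ση = η`. [cite: Rogawski1990, §4.8 Case (a) p. 53] -/
theorem oneByOne_map_transpose {K : Type*} [Field K] (σ : K →+* K) {η : K} (h : σ η = η) :
    ((!![η] : Matrix (Fin 1) (Fin 1) K).map σ)ᵀ = !![η] := by
  ext i j; fin_cases i; fin_cases j
  simp [h]

/-- **The cyclic frame in the endoscopic pattern**: `ι(C, 1) · ι(G₁, u) = ι(g, u) · ι(C, 1)` for `g·C = C·G₁` (★ `literal_mul_cyclicFrame_eq` dressed `3 × 3`).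
[cite: Rogawski1990, §3.6 p. 31; §4.8 Case (a) p. 53] -/
theorem endoPattern_cyclicFrame_mul_eq {K : Type*} [Field K] {p q r D φ₀ φ₁ : K} (u : K) (hD : p * p + q * r = D) :
    (!![(1 : K), 0, p; 0, 1, 0; 0, 0, r] : Matrix (Fin 3) (Fin 3) K) * !![φ₀, 0, φ₁ * D; 0, u, 0; φ₁, 0, φ₀] =
      !![φ₀ + φ₁ * p, 0, φ₁ * q; 0, u, 0; φ₁ * r, 0, φ₀ - φ₁ * p] * !![(1 : K), 0, p; 0, 1, 0; 0, 0, r] := by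
  ext i j
  fin_cases i <;> fin_cases j <;> simp [Matrix.mul_apply, Fin.sum_univ_three]
  all_goals first | ring1 | linear_combination φ₁ * hD | linear_combination (-φ₁) * hD

/-- The middle entry of `endoForm J₂ (η)` is `η`. [cite: Rogawski1990, §4.8 Case (a) p. 53] -/
theorem endoForm_apply_one_one {K : Type*} [Field K] (J₂ : Matrix (Fin 2) (Fin 2) K) (η : K) : endoForm J₂ !![η] 1 1 = η := by
  rw [endoForm_eq]; simp

/-- A σ-fixed unit which is a NORM has SQUARE residue, so by Hensel it is a square: contrapositive — **a σ_w-fixed unit `D` of `L_w` which is not a square is not a norm `s·σ_w s`**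
(tame-ramified `w`, `|2|_w = 1`; ★ (U1) + ★ `isSquare_coe_of_isUnit_of_isSquare_residue`). [cite: Serre1979, Ch. V §3 Cor. 2; Ch. II §3] -/
theorem not_exists_mul_galAdicCompletionMap_eq_of_not_isSquare (he : v.asIdeal.ramificationIdx' w.1.asIdeal ≠ 1)
    (h2 : Valued.v (2 : w.1.adicCompletion L) = 1) {D : w.1.adicCompletion L} (hvD : Valued.v D = 1)
    (hσD : galAdicCompletionMap (L := L) (IsCMField.complexConj L) hw D = D) (hns : ¬ IsSquare D) :
    ¬ ∃ s : w.1.adicCompletion L, s * galAdicCompletionMap (L := L) (IsCMField.complexConj L) hw s = D := by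
  rintro ⟨s, hs⟩
  have hs1 : Valued.v s = 1 := valued_eq_one_of_mul_galAdicCompletionMap_valued_eq_one L (IsCMField.complexConj L) v w hw (by rw [hs, hvD])
  have hsq := (exists_mul_galAdicCompletionMap_eq_iff_isSquare_residue_of_ramified_complexConj L w hw he h2 hvD hσD).1 ⟨s, hs1, hs⟩
  have h2' : ValuativeRel.valuation (w.1.adicCompletion L) (2 : w.1.adicCompletion L) = 1 := (v_eq_one_iff_valuation_eq_one _).1 h2
  exact hns (isSquare_coe_of_isUnit_of_isSquare_residue h2' _ (isUnit_integer_of_v_eq_one w.1 hvD) hsq)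

include hw in
/-- **THE ANISOTROPIC BLOCK** (first half of the literal): for `g ∈ U(Φ₂) ≤ GL₂(L_w)` with rootless `χ_g`, `g ≡ 1 (mod ϖ²)`, at a tamely ramified `w`: a cyclic frame
`C = (1 p; 0 r)` with `G₁ := C⁻¹gC = (φ₀ φ₁D; φ₁ φ₀) ≡ 1 (mod ϖ²)`, the intertwining `ι(C,1)·ι(G₁,u) = ι(g,u)·ι(C,1)` for every `u ∈ GL₁`, and a UNIMODULAR σ-hermitian
plane `Ψ` with `G₁ ∈ U(Ψ)` whose class `η = (−det Ψ)⁻¹` is a σ-fixed unit which is NOT a norm (§1 generator, §2 twist data, ★ `regRep_unitary`).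
[cite: Rogawski1990, §3.5 Prop. 3.5.2 (a)(c) p. 29; §3.6 p. 31] [cite: LabesseLanglands1979, §2 pp. 8–10] -/
theorem exists_anisotropicBlock_ram (he : v.asIdeal.ramificationIdx' w.1.asIdeal ≠ 1) (h2 : Valued.v (2 : (w.1.adicCompletion L)) = 1)
    {ϖ : (w.1.adicCompletion L)} (hϖ : Valued.v ϖ = WithZero.exp (-1 : ℤ)) (hσϖ : galAdicCompletionMap (L := L) (IsCMField.complexConj L) hw ϖ = -ϖ)
    (g : GL (Fin 2) (w.1.adicCompletion L)) (hgU : g ∈ unitaryGroupOfForm (galAdicCompletionMap (L := L) (IsCMField.complexConj L) hw) !![(0 : (w.1.adicCompletion L)), 1; 1, 0])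
    (hA : ∀ x : (w.1.adicCompletion L), (g : Matrix (Fin 2) (Fin 2) (w.1.adicCompletion L)).charpoly.eval x ≠ 0)
    (hg2 : ∀ i j, Valued.v (((g : Matrix (Fin 2) (Fin 2) (w.1.adicCompletion L)) - 1) i j) ≤ Valued.v (ϖ ^ 2)) :
    ∃ (C G₁ : GL (Fin 2) (w.1.adicCompletion L)) (Ψ : Matrix (Fin 2) (Fin 2) (w.1.adicCompletion L)) (η : (w.1.adicCompletion L)),
      (∀ i j, Valued.v (((G₁ : Matrix (Fin 2) (Fin 2) (w.1.adicCompletion L)) - 1) i j) ≤ Valued.v (ϖ ^ 2)) ∧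
      (∀ uu : GL (Fin 1) (w.1.adicCompletion L), endoGL (C, (1 : GL (Fin 1) (w.1.adicCompletion L))) * endoGL (G₁, uu) = endoGL (g, uu) * endoGL (C, (1 : GL (Fin 1) (w.1.adicCompletion L)))) ∧
      (∀ uu : GL (Fin 1) (w.1.adicCompletion L), ((endoGL (G₁, uu) : GL (Fin 3) (w.1.adicCompletion L)) : Matrix (Fin 3) (Fin 3) (w.1.adicCompletion L)) 1 1 = (uu : Matrix (Fin 1) (Fin 1) (w.1.adicCompletion L)) 0 0 ∧
        ∀ i : Fin 3, i ≠ 1 → ((endoGL (G₁, uu) : GL (Fin 3) (w.1.adicCompletion L)) : Matrix (Fin 3) (Fin 3) (w.1.adicCompletion L)) i 1 = 0) ∧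
      G₁ ∈ unitaryGroupOfForm (galAdicCompletionMap (L := L) (IsCMField.complexConj L) hw) Ψ ∧ (Ψ.map (galAdicCompletionMap (L := L) (IsCMField.complexConj L) hw))ᵀ = Ψ ∧ IsIntMatrix Ψ ∧ Valued.v Ψ.det = 1 ∧
      η = (-Ψ.det)⁻¹ ∧ galAdicCompletionMap (L := L) (IsCMField.complexConj L) hw η = η ∧ Valued.v η = 1 ∧
      ¬ ∃ t : (w.1.adicCompletion L), t * galAdicCompletionMap (L := L) (IsCMField.complexConj L) hw t = η := by
  set σ := galAdicCompletionMap (L := L) (IsCMField.complexConj L) hw with hσdef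
  have hc1 : IsCMField.complexConj L ≠ 1 := IsCMField.complexConj_ne_one L
  have hσσ : ∀ x, σ (σ x) = x := fun x => galAdicCompletionMap_galAdicCompletionMap_of_smul_eq (IsCMField.complexConj L) w hc1 hw x
  have hvσ : ∀ x, Valued.v (σ x) = Valued.v x := fun x => valued_galAdicCompletionMap (L := L) (IsCMField.complexConj L) hw x
  obtain ⟨-, -, -, -, hnorm⟩ := ramifiedBlock_adicCompletion L v w hw he h2
  -- §1: the signed generator and the coordinates
  have hgu := (mem_unitaryGroupOfForm_iff.1 hgU)
  obtain ⟨p, q₀, r, D, φ₀, φ₁, s₀, hs₀, hσs₀, hp, hq, hr, hσD, hDsum, hr0, hvD, hnsD, hglit, R1, R2⟩ :=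
    exists_signedGenerator_coords_ramified L w hw he h2 hϖ hσϖ (g : Matrix (Fin 2) (Fin 2) (w.1.adicCompletion L)) hgu hA
  have hss : s₀ * s₀ = 1 := by rcases hs₀ with rfl | rfl <;> norm_num
  have hvs₀ : Valued.v s₀ = 1 := by rcases hs₀ with rfl | rfl <;> simp
  -- 2-deep coordinates (no level loss)
  have hg2' : ∀ a b, Valued.v (((!![φ₀ + φ₁ * p, φ₁ * q₀; φ₁ * r, φ₀ - φ₁ * p] : Matrix (Fin 2) (Fin 2) (w.1.adicCompletion L)) - 1) a b) ≤
      Valued.v (ϖ ^ 2) := by rw [← hglit]; exact hg2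
  obtain ⟨hφ₀, hφ₁⟩ := valued_coords_of_entrywise_le hDsum hvD h2 hg2'
  -- §2: the twist data and the anisotropic unimodular plane `Ψ`
  obtain ⟨x, y, hσx, hσy, hx1, hy1, hm⟩ := exists_twistData_ramified L w hw he h2 hs₀ hvD
  obtain ⟨Ψ, hΨdef⟩ : ∃ Ψ : Matrix (Fin 2) (Fin 2) (w.1.adicCompletion L), Ψ = !![x, y * D; s₀ * D * y, s₀ * D * x] := ⟨_, rfl⟩
  have hΨh : (Ψ.map σ)ᵀ = Ψ := by rw [hΨdef]; exact twistForm_hermitian σ hss hσD hσx hσy hσs₀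
  have hΨdet : Ψ.det = s₀ * D * (x * x - D * (y * y)) := by rw [hΨdef]; exact det_twistForm D s₀ x y
  have hnv : Valued.v (x * x - D * (y * y)) = 1 := by
    have e : x * x - D * (y * y) = (x * x - D * (y * y) + s₀) - s₀ := by ring
    rw [e, Valuation.map_sub_eq_of_lt_right _ (by rw [hvs₀]; exact hm), hvs₀]
  have hvΨdet : Valued.v Ψ.det = 1 := by rw [hΨdet, map_mul, map_mul, hvs₀, hvD, hnv, one_mul, one_mul]
  have hσΨdet : σ Ψ.det = Ψ.det := by
    rw [hΨdet, map_mul, map_mul, map_sub, map_mul, map_mul, map_mul, hσs₀, hσD, hσx, hσy]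
    linear_combination (-(s₀ * D * D * (y * y))) * hss
  have hΨint : IsIntMatrix Ψ := by
    intro i j
    rw [hΨdef]
    fin_cases i <;> fin_cases j <;> simp
    · exact hx1
    · rw [hvD, mul_one]; exact hy1
    · rw [hvs₀, hvD, one_mul, one_mul]; exact hy1
    · rw [hvs₀, hvD, one_mul, one_mul]; exact hx1
  obtain ⟨η, hηdef⟩ : ∃ η : (w.1.adicCompletion L), η = (-Ψ.det)⁻¹ := ⟨_, rfl⟩
  have hση : σ η = η := by rw [hηdef, map_inv₀, map_neg, hσΨdet]
  have hvη : Valued.v η = 1 := by rw [hηdef, map_inv₀, Valuation.map_neg, hvΨdet, inv_one]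
  have hη0 : η ≠ 0 := fun h0 => by rw [h0, map_zero] at hvη; exact zero_ne_one hvη
  -- `η` is NOT a norm: else `D = N(s)` and `D` would be a square
  have hηN : ¬ ∃ t : (w.1.adicCompletion L), t * σ t = η := by
    rintro ⟨t, ht⟩
    obtain ⟨m, hmdef⟩ : ∃ m : (w.1.adicCompletion L), m = x * x - D * (y * y) + s₀ := ⟨_, rfl⟩
    rw [← hmdef] at hm
    have hσm : σ m = m := by
      rw [hmdef, map_add, map_sub, map_mul, map_mul, map_mul, hσx, hσD, hσy, hσs₀]
      linear_combination (-(D * (y * y))) * hss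
    have hu₁ : σ (1 - s₀ * m) = 1 - s₀ * m := by rw [map_sub, map_one, map_mul, hσs₀, hσm]
    have hu₁1 : Valued.v (1 - s₀ * m - 1) < 1 := by
      rw [show 1 - s₀ * m - 1 = -(s₀ * m) by ring, Valuation.map_neg, map_mul, hvs₀, one_mul]; exact hm
    obtain ⟨z, hz, -⟩ := hnorm (1 - s₀ * m) hu₁ hu₁1
    have hkey : -Ψ.det = D * (1 - s₀ * m) := by
      rw [hΨdet, hmdef]; linear_combination D * hss
    have hu₁0 : (1 : (w.1.adicCompletion L)) - s₀ * m ≠ 0 := by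
      intro h0
      have h := hu₁1
      rw [h0, zero_sub, Valuation.map_neg, map_one] at h
      exact lt_irrefl _ h
    have hD0 : D ≠ 0 := fun h0 => by rw [h0, map_zero] at hvD; exact zero_ne_one hvD
    apply not_exists_mul_galAdicCompletionMap_eq_of_not_isSquare L w hw he h2 hvD hσD hnsD
    refine ⟨(t * z)⁻¹, ?_⟩
    rw [map_inv₀, map_mul, ← mul_inv, show t * z * (σ t * σ z) = (t * σ t) * (z * σ z) by ring, ht, hz, hηdef, hkey]
    field_simp
  -- the cyclic frame `C = (1 p; 0 r)` and the regular representation `G₁ = C⁻¹ g C = (φ₀ φ₁D; φ₁ φ₀)`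
  obtain ⟨C, hCval⟩ : ∃ C : GL (Fin 2) (w.1.adicCompletion L), (C : Matrix (Fin 2) (Fin 2) (w.1.adicCompletion L)) = !![(1 : (w.1.adicCompletion L)), p; 0, r] :=
    ⟨Matrix.GeneralLinearGroup.mkOfDetNeZero !![(1 : (w.1.adicCompletion L)), p; 0, r] (by rw [det_cyclicFrame]; exact hr0),
      Matrix.GeneralLinearGroup.val_mkOfDetNeZero _ _⟩
  obtain ⟨G₁, hG₁def⟩ : ∃ G₁ : GL (Fin 2) (w.1.adicCompletion L), G₁ = C⁻¹ * g * C := ⟨_, rfl⟩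
  have hG₁val : (G₁ : Matrix (Fin 2) (Fin 2) (w.1.adicCompletion L)) = !![φ₀, φ₁ * D; φ₁, φ₀] := by
    have hgC : (g : Matrix (Fin 2) (Fin 2) (w.1.adicCompletion L)) * C = C * !![φ₀, φ₁ * D; φ₁, φ₀] := by
      rw [hCval, hglit]; exact literal_mul_cyclicFrame_eq hDsum
    have hCC : ((C⁻¹ : GL (Fin 2) (w.1.adicCompletion L)) : Matrix (Fin 2) (Fin 2) (w.1.adicCompletion L)) * C = 1 := by
      rw [← Units.val_mul, inv_mul_cancel, Units.val_one]
    rw [hG₁def, Units.val_mul, Units.val_mul, Matrix.mul_assoc, hgC, ← Matrix.mul_assoc, hCC, Matrix.one_mul]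
  have hG₁U : G₁ ∈ unitaryGroupOfForm σ Ψ := by
    rw [mem_unitaryGroupOfForm_iff, hG₁val, hΨdef]
    exact regRep_unitary σ x y hss hσD R1 R2
  have hG₁2 : ∀ i j, Valued.v (((G₁ : Matrix (Fin 2) (Fin 2) (w.1.adicCompletion L)) - 1) i j) ≤ Valued.v (ϖ ^ 2) := by
    rw [hG₁val]; exact valued_regRep_sub_one_le hφ₀ hφ₁ hvD.le
  -- the intertwining in the endoscopic pattern, at the matrix level
  have hEval : ((endoGL (C, (1 : GL (Fin 1) (w.1.adicCompletion L)))) : Matrix (Fin 3) (Fin 3) (w.1.adicCompletion L)) = !![(1 : (w.1.adicCompletion L)), 0, p; 0, 1, 0; 0, 0, r] := by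
    rw [coe_endoGL_eq, hCval, Units.val_one, Matrix.one_apply_eq]; rfl
  have hinter : ∀ uu : GL (Fin 1) (w.1.adicCompletion L), endoGL (C, (1 : GL (Fin 1) (w.1.adicCompletion L))) * endoGL (G₁, uu) = endoGL (g, uu) * endoGL (C, (1 : GL (Fin 1) (w.1.adicCompletion L))) := by
    intro uu
    have hXval : ((endoGL (g, uu)) : Matrix (Fin 3) (Fin 3) (w.1.adicCompletion L)) = !![φ₀ + φ₁ * p, 0, φ₁ * q₀; 0, ((uu : Matrix (Fin 1) (Fin 1) (w.1.adicCompletion L)) 0 0), 0; φ₁ * r, 0, φ₀ - φ₁ * p] := by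
      rw [coe_endoGL_eq, hglit]; rfl
    have hWval : ((endoGL (G₁, uu)) : Matrix (Fin 3) (Fin 3) (w.1.adicCompletion L)) = !![φ₀, 0, φ₁ * D; 0, ((uu : Matrix (Fin 1) (Fin 1) (w.1.adicCompletion L)) 0 0), 0; φ₁, 0, φ₀] := by
      rw [coe_endoGL_eq, hG₁val]; rfl
    exact Units.ext (by rw [Units.val_mul, Units.val_mul, hEval, hWval, hXval]; exact endoPattern_cyclicFrame_mul_eq _ hDsum)
  have hcol : ∀ uu : GL (Fin 1) (w.1.adicCompletion L), ((endoGL (G₁, uu) : GL (Fin 3) (w.1.adicCompletion L)) : Matrix (Fin 3) (Fin 3) (w.1.adicCompletion L)) 1 1 = (uu : Matrix (Fin 1) (Fin 1) (w.1.adicCompletion L)) 0 0 ∧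
      ∀ i : Fin 3, i ≠ 1 → ((endoGL (G₁, uu) : GL (Fin 3) (w.1.adicCompletion L)) : Matrix (Fin 3) (Fin 3) (w.1.adicCompletion L)) i 1 = 0 := by
    intro uu
    refine ⟨by rw [coe_endoGL_eq]; rfl, fun i hi => ?_⟩
    rw [coe_endoGL_eq]
    fin_cases i
    · rfl
    · exact absurd rfl hi
    · rfl
  exact ⟨C, G₁, Ψ, η, hG₁2, hinter, hcol, hG₁U, hΨh, hΨint, hvΨdet, hηdef, hση, hvη, hηN⟩

include hw in
/-- **THE ANISOTROPIC 2-DEEP LITERAL OF A TYPE-(2) ELEMENT AT A TAMELY RAMIFIED PLACE.**  `w ∣ v` non-split, `e(w|v) ≠ 1`, `|2|_w = 1`, `ϖ` an anti-fixed uniformiser;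
`g ∈ U(Φ₂) ≤ GL₂(L_w)` with rootless `χ_g` and `g ≡ 1 (mod ϖ²)` entrywise; `u ∈ GL₁(L_w)` with `σu·u = 1`, `u ≡ 1 (mod ϖ²)`.  Then there are `Y ∈ U(σ_w, J₀) ≤ GL₃(L_w)`
(`J₀ = antidiag(1,1,1)`), a vector `q ∈ L_w³` and a scalar `η` with: `Y ≡ 1 (mod ϖ²)` entrywise; `Y` is `GL₃(L_w)`-CONJUGATE to the endoscopic pattern `endoGL(g, u)`;
`Y·q = u·q`, `q ≠ 0`, and the `J₀`-length `Σ σ(qᵢ)(J₀)ᵢₖq_k = η` is a σ-fixed UNIT WHICH IS NOT A NORM.  (`Y = P·endoGL(G₁, u)·P⁻¹` with `G₁` the regular representation of `g` on its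
`⋆`-eigen generator, `P ∈ GL₃(𝒪_w)` the integral isometry ★ p846940 onto `H₃ = Ψ ⊥ (η)`, `Ψ` the anisotropic twist, `η = (−det Ψ)⁻¹`, `q = P e₁` — `exists_anisotropicBlock_ram`.)
Pulled back along the wave's one-place frame this is the (Lit2) literal of sign `−(y_λ, θ)_v`. [cite: Rogawski1990, §3.5 Prop. 3.5.2 (a)(c) p. 29; §3.6 p. 31; §4.9 Prop. 4.9.1 p. 55]
[cite: LabesseLanglands1979, §2 pp. 8–10] [cite: Jacobowitz1962, §8] -/
theorem exists_anisotropicLiteral_ram (he : v.asIdeal.ramificationIdx' w.1.asIdeal ≠ 1) (h2 : Valued.v (2 : (w.1.adicCompletion L)) = 1)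
    {ϖ : (w.1.adicCompletion L)} (hϖ : Valued.v ϖ = WithZero.exp (-1 : ℤ)) (hσϖ : galAdicCompletionMap (L := L) (IsCMField.complexConj L) hw ϖ = -ϖ)
    (g : GL (Fin 2) (w.1.adicCompletion L)) (hgU : g ∈ unitaryGroupOfForm (galAdicCompletionMap (L := L) (IsCMField.complexConj L) hw) !![(0 : (w.1.adicCompletion L)), 1; 1, 0])
    (hA : ∀ x : (w.1.adicCompletion L), (g : Matrix (Fin 2) (Fin 2) (w.1.adicCompletion L)).charpoly.eval x ≠ 0)
    (hg2 : ∀ i j, Valued.v (((g : Matrix (Fin 2) (Fin 2) (w.1.adicCompletion L)) - 1) i j) ≤ Valued.v (ϖ ^ 2))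
    (uu : GL (Fin 1) (w.1.adicCompletion L)) (hu1 : galAdicCompletionMap (L := L) (IsCMField.complexConj L) hw ((uu : Matrix (Fin 1) (Fin 1) (w.1.adicCompletion L)) 0 0) * ((uu : Matrix (Fin 1) (Fin 1) (w.1.adicCompletion L)) 0 0) = 1) (hu2 : Valued.v (((uu : Matrix (Fin 1) (Fin 1) (w.1.adicCompletion L)) 0 0) - 1) ≤ Valued.v (ϖ ^ 2)) :
    ∃ (Y : GL (Fin 3) (w.1.adicCompletion L)) (q : Fin 3 → (w.1.adicCompletion L)) (η : (w.1.adicCompletion L)),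
      Y ∈ unitaryGroupOfForm (galAdicCompletionMap (L := L) (IsCMField.complexConj L) hw) ((StdForm.antidiagonal 3).over (w.1.adicCompletion L)) ∧
      (∀ i j, Valued.v (((Y : Matrix (Fin 3) (Fin 3) (w.1.adicCompletion L)) - 1) i j) ≤ Valued.v (ϖ ^ 2)) ∧
      IsConj (endoGL (g, uu)) Y ∧
      (Y : Matrix (Fin 3) (Fin 3) (w.1.adicCompletion L)) *ᵥ q = ((uu : Matrix (Fin 1) (Fin 1) (w.1.adicCompletion L)) 0 0) • q ∧ q ≠ 0 ∧
      (∑ i : Fin 3, ∑ k : Fin 3, galAdicCompletionMap (L := L) (IsCMField.complexConj L) hw (q i) * (StdForm.antidiagonal 3).over (w.1.adicCompletion L) i k * q k) = η ∧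
      galAdicCompletionMap (L := L) (IsCMField.complexConj L) hw η = η ∧ Valued.v η = 1 ∧ ¬ ∃ t : (w.1.adicCompletion L), t * galAdicCompletionMap (L := L) (IsCMField.complexConj L) hw t = η := by
  set σ := galAdicCompletionMap (L := L) (IsCMField.complexConj L) hw with hσdef
  obtain ⟨C, G₁, Ψ, η, hG₁2, hinter, hcol, hG₁U, hΨh, hΨint, hvΨdet, hηdef, hση, hvη, hηN⟩ :=
    exists_anisotropicBlock_ram L w hw he h2 hϖ hσϖ g hgU hA hg2
  have hΨdet0 : Ψ.det ≠ 0 := fun h0 => by rw [h0, map_zero] at hvΨdet; exact zero_ne_one hvΨdet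
  -- the `3 × 3` dress `H₃ = Ψ ⊥ (η)` and the integral isometry `P`
  obtain ⟨H₃, hH₃def⟩ : ∃ H₃ : Matrix (Fin 3) (Fin 3) (w.1.adicCompletion L), H₃ = endoForm Ψ !![η] := ⟨_, rfl⟩
  have hH₃h : (H₃.map σ)ᵀ = H₃ := by
    rw [hH₃def, endoForm_map_transpose, hΨh, oneByOne_map_transpose σ hση]
  have hH₃int : IsIntMatrix H₃ := by
    intro i j
    rw [hH₃def, endoForm_eq]
    fin_cases i <;> fin_cases j <;> simp
    · exact hΨint 0 0
    · exact hΨint 0 1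
    · exact hvη.le
    · exact hΨint 1 0
    · exact hΨint 1 1
  have hH₃det : H₃.det = -1 := by
    rw [hH₃def, det_endoForm, Matrix.det_fin_one_of, hηdef]
    field_simp
  have hvH₃det : Valued.v H₃.det = 1 := by rw [hH₃det, Valuation.map_neg, map_one]
  have hc : σ 1 * 1 = -H₃.det := by rw [map_one, mul_one, hH₃det, neg_neg]
  obtain ⟨P, hPint, hPform⟩ := exists_glInt_formCongr_antidiagonal_eq_of_map_mul_self_eq_neg_det_adicCompletion L w hw he h2 hH₃h hH₃int hvH₃det hc
  have hPi : ∀ a b, Valued.v ((P : Matrix (Fin 3) (Fin 3) (w.1.adicCompletion L)) a b) ≤ 1 := fun a b =>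
    (v_le_one_iff_mem_integer _).2 (((mem_glInt_iff P).1 hPint).1 a b)
  have hPii : ∀ a b, Valued.v (((P⁻¹ : GL (Fin 3) (w.1.adicCompletion L)) : Matrix (Fin 3) (Fin 3) (w.1.adicCompletion L)) a b) ≤ 1 := fun a b =>
    (v_le_one_iff_mem_integer _).2 (((mem_glInt_iff P).1 hPint).2 a b)
  -- `uu ∈ U(η)` and the literal `W = ι(G₁, u) ∈ U(H₃)`, `Y = P W P⁻¹ ∈ U(J₀)`
  have huumat : (uu : Matrix (Fin 1) (Fin 1) (w.1.adicCompletion L)) = !![((uu : Matrix (Fin 1) (Fin 1) (w.1.adicCompletion L)) 0 0)] := by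
    ext i j; fin_cases i; fin_cases j; rfl
  have huU : uu ∈ unitaryGroupOfForm σ !![η] := by
    rw [mem_unitaryGroupOfForm_iff, huumat]
    exact oneByOne_map_transpose_mul_mul σ η hu1
  obtain ⟨W, hWdef⟩ : ∃ W : GL (Fin 3) (w.1.adicCompletion L), W = endoGL (G₁, uu) := ⟨_, rfl⟩
  have hWU : W ∈ unitaryGroupOfForm σ H₃ := by
    rw [hWdef, hH₃def]; exact (endoGL_mem_iff σ Ψ !![η] G₁ uu).2 ⟨hG₁U, huU⟩
  obtain ⟨Y, hYdef⟩ : ∃ Y : GL (Fin 3) (w.1.adicCompletion L), Y = P * W * P⁻¹ := ⟨_, rfl⟩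
  have hYU : Y ∈ unitaryGroupOfForm σ ((StdForm.antidiagonal 3).over (w.1.adicCompletion L)) := by
    rw [hYdef]
    exact (conj_mem_unitaryGroupOfForm_iff σ P _ W).2 (by rw [hPform]; exact hWU)
  -- 2-depth: `W − 1` is the pattern of `(G₁ − 1, u − 1)`
  obtain ⟨hW11, hWi1⟩ := hcol uu
  have hW2 : ∀ i j, Valued.v (((W : Matrix (Fin 3) (Fin 3) (w.1.adicCompletion L)) - 1) i j) ≤ Valued.v (ϖ ^ 2) := by
    have h := valued_endoPattern_sub_one_le (a := (G₁ : Matrix (Fin 2) (Fin 2) (w.1.adicCompletion L)) 0 0) (b := (G₁ : Matrix (Fin 2) (Fin 2) (w.1.adicCompletion L)) 0 1)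
      (c' := (G₁ : Matrix (Fin 2) (Fin 2) (w.1.adicCompletion L)) 1 0) (d := (G₁ : Matrix (Fin 2) (Fin 2) (w.1.adicCompletion L)) 1 1) (u := ((uu : Matrix (Fin 1) (Fin 1) (w.1.adicCompletion L)) 0 0)) (cc := ϖ ^ 2) ?_ hu2
    · rw [hWdef, coe_endoGL_eq]; exact h
    · have e : (!![(G₁ : Matrix (Fin 2) (Fin 2) (w.1.adicCompletion L)) 0 0, (G₁ : Matrix (Fin 2) (Fin 2) (w.1.adicCompletion L)) 0 1; (G₁ : Matrix (Fin 2) (Fin 2) (w.1.adicCompletion L)) 1 0,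
          (G₁ : Matrix (Fin 2) (Fin 2) (w.1.adicCompletion L)) 1 1] : Matrix (Fin 2) (Fin 2) (w.1.adicCompletion L)) = (G₁ : Matrix (Fin 2) (Fin 2) (w.1.adicCompletion L)) := by
        ext i j; fin_cases i <;> fin_cases j <;> rfl
      rw [e]; exact hG₁2
  have hY2 : ∀ i j, Valued.v (((Y : Matrix (Fin 3) (Fin 3) (w.1.adicCompletion L)) - 1) i j) ≤ Valued.v (ϖ ^ 2) := by
    have h := valued_conj_sub_one_le (P⁻¹) hPii (by rw [inv_inv]; exact hPi) (W : Matrix (Fin 3) (Fin 3) (w.1.adicCompletion L)) hW2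
    rw [inv_inv] at h
    rw [hYdef, Units.val_mul, Units.val_mul]
    exact h
  -- conjugacy with the pattern
  have hconj : IsConj (endoGL (g, uu)) Y := by
    have h1 : IsConj W (endoGL (g, uu)) :=
      ⟨toUnits (endoGL (C, (1 : GL (Fin 1) (w.1.adicCompletion L)))), by rw [SemiconjBy, val_toUnits_apply, hWdef]; exact hinter uu⟩
    have h2' : IsConj W Y := isConj_iff.2 ⟨P, hYdef.symm⟩
    exact h1.symm.trans h2'
  -- the eigenvector `q = P e₁` and its length `η`
  obtain ⟨qv, hqvdef⟩ : ∃ qv : Fin 3 → (w.1.adicCompletion L), qv = fun i => (P : Matrix (Fin 3) (Fin 3) (w.1.adicCompletion L)) i 1 := ⟨_, rfl⟩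
  have hqP : (P : Matrix (Fin 3) (Fin 3) (w.1.adicCompletion L)) *ᵥ (Pi.single 1 1 : Fin 3 → (w.1.adicCompletion L)) = qv := by
    rw [Matrix.mulVec_single_one, hqvdef]; funext i; rw [Matrix.col_apply]
  have hWe : (W : Matrix (Fin 3) (Fin 3) (w.1.adicCompletion L)) *ᵥ (Pi.single 1 1 : Fin 3 → (w.1.adicCompletion L)) = ((uu : Matrix (Fin 1) (Fin 1) (w.1.adicCompletion L)) 0 0) • (Pi.single 1 1 : Fin 3 → (w.1.adicCompletion L)) := by
    rw [Matrix.mulVec_single_one]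
    funext i
    rw [Pi.smul_apply, smul_eq_mul, Matrix.col_apply, hWdef]
    by_cases hi : i = 1
    · rw [hi, hW11, Pi.single_eq_same, mul_one]
    · rw [hWi1 i hi, Pi.single_eq_of_ne hi, mul_zero]
  have hPP : ((P⁻¹ : GL (Fin 3) (w.1.adicCompletion L)) : Matrix (Fin 3) (Fin 3) (w.1.adicCompletion L)) * (P : Matrix (Fin 3) (Fin 3) (w.1.adicCompletion L)) = 1 := by
    rw [← Units.val_mul, inv_mul_cancel, Units.val_one]
  have hYq : (Y : Matrix (Fin 3) (Fin 3) (w.1.adicCompletion L)) *ᵥ qv = ((uu : Matrix (Fin 1) (Fin 1) (w.1.adicCompletion L)) 0 0) • qv := by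
    rw [← hqP, hYdef, Units.val_mul, Units.val_mul, Matrix.mulVec_mulVec, Matrix.mul_assoc, hPP, Matrix.mul_one, ← Matrix.mulVec_mulVec, hWe,
      Matrix.mulVec_smul]
  have hq0 : qv ≠ 0 := by
    intro h0
    have h : ((P⁻¹ : GL (Fin 3) (w.1.adicCompletion L)) : Matrix (Fin 3) (Fin 3) (w.1.adicCompletion L)) *ᵥ ((P : Matrix (Fin 3) (Fin 3) (w.1.adicCompletion L)) *ᵥ (Pi.single 1 1 : Fin 3 → (w.1.adicCompletion L))) = 0 := by
      rw [hqP, h0, Matrix.mulVec_zero]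
    rw [Matrix.mulVec_mulVec, hPP, Matrix.one_mulVec] at h
    have h1 := congr_fun h (1 : Fin 3)
    rw [Pi.single_eq_same, Pi.zero_apply] at h1
    exact one_ne_zero h1
  have hlen : (∑ i : Fin 3, ∑ k : Fin 3, σ (qv i) * (StdForm.antidiagonal 3).over (w.1.adicCompletion L) i k * qv k) = η := by
    have h11 : formCongr σ P ((StdForm.antidiagonal 3).over (w.1.adicCompletion L)) 1 1 = η := by
      rw [hPform, hH₃def]; exact endoForm_apply_one_one Ψ η
    rw [← h11]
    simp only [formCongr, Matrix.mul_apply, Matrix.transpose_apply, Matrix.map_apply, Finset.sum_mul, hqvdef]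
    rw [Finset.sum_comm]
  exact ⟨Y, qv, η, hYU, hY2, hconj, hYq, hq0, hlen, hση, hvη, hηN⟩

end CM

end Literature.NumberTheory.Rogawski1990

end
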